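import Summits.QuantumFields.YangMills.Theorems.ThermalDescentMaxwellRungChain

/-!
# `ThermalDescent` / `ZeroTemperatureFloors` (stmt-QuantumFields-25390) BC5 rung — file 6/6 (MAIN): the thermal free Maxwell₄
# field as a DECIDED SEPARATING MODEL (zero-temperature floor TRUE uniformly in the period; NT clause (ii) FALSE at every
# temperature)

Tribunal-w seat `ym-td-bc5w-1` (planner, gen 2).  The six files `ThermalDescentMaxwellRung{Defs,Kernel,Images,Window,
Chain,Floors}` are the ≤ 400-line Theorems split of the crux workfile
`Cruxes/ZeroTemperatureFloors/Lines/rung_maxwell.lean` (commit 53ced2b6fc84): the thermal free Maxwell₄ field as a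
DECIDED SEPARATING MODEL for the deciding crux `ZeroTemperatureFloors` (stmt-QuantumFields-25390) of route
`ThermalDescent` — statement, dictionary and mechanism in `…Floors`.  Helper files (`--supports` the crux), close nothing;
route-independent (imports `Mathlib`, the Mathlib-only certificate `TreeLevelSkewnessVanishes`, `Literature…EuclideanAction`).

**The crux.** `Theses.ThermalDescent.ZeroTemperatureFloors` asks, for a lattice representation and a
unit map `a(β) → 0`, for ONE test function `v` supported in a positive-time slab `{δ₁ < y₀ < δ₂}`
(`δ₁ > 0`) and ONE `ε > 0` with `ε ≤ Qrp_β((2L+1)³ × 2^k(2L+1))(a(β), v)` — the reflected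
plaquette-energy covariance `Cov(B∘refl, B)` on the LONG tori of time extent `2^k(2L+1)` — for all
`β ≥ β₅`, `a(β)L ≥ Λ₅`, `k ≥ k₀`.  Its distinctive content relative to the sub-problem statement
`BalabanLadder.NT` (hypercubic tori, clauses (i) two-point floor, (ii) connected three-point floor) is
the survival of the reflection floor in the ZERO-TEMPERATURE limit `k → ∞` (inverse temperature
`T = a·2^k(2L+1) → ∞`).

**The model (dictionary).** The free Maxwell field of `d = 4` at inverse temperature `T` (time
period `T`), in the normalisation of the tree's `maxwellKernel` (the model that refuted
`SelfNormalisedSkewness`; restated here route-independently, §0): field-strength covariance = the IMAGE SUM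
`G_T(z) = K(H_T(z))`, `H_T(z) = Σ_{n∈ℤ} ∂∂|z + nTe₀|⁻²` (`thermalHess`, `thermalKernel`; entrywise
`tsum`, absolutely convergent for `T > 0` — `summable_entry_img`); plaquette energy ↦ Wick square
`F² = F_{μν}F_{μν}`; `Qrp(v)` ↦ `2·R₂^T(v) = 2 ∫∫ v(x) v(θy) tr G_T(x−y)G_T(y−x)` (`thermalRing2`, Wick's
rule); NT's clause-(ii) three-point function ↦ `8·R₃^T` (`thermalRing3`); the vacuum `T = ∞` member is
`vacuumRing2 / vacuumRing3` (verbatim the tree's `maxwellRing2 / maxwellRing3`).  The coupling `β` is absent: the free field is already the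
formal `β → ∞` limit of compact `U(1)` (with the crux's bare density the literal `U(1)` floor is
`O(β⁻²) → 0`, false for a trivial normalisation reason — hence the free-field analogue, as for FRM).

**Rung (crux analogue TRUE — `thermalMaxwell_zeroTemperatureFloor`, sorry-free).** There is ONE
`κ > 0` (`κTh`, free of `ℓ` and `T`) such that at every scale `ℓ > 0` the `[0,1]`-valued slab bump
`w_ℓ` (centre `(ℓ/2)e₀`, radii `ℓ/16 < ℓ/8`, `tsupport ⊆ {ℓ/4 < y₀ < 3ℓ/4}`) has
`κ ≤ 2·R₂^T(w_ℓ)` for EVERY period `T ≥ 3ℓ`, and `κ ≤ 2·R₂(w_ℓ)` in the vacuum;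
`thermalMaxwell_zeroTemperatureFloor_cruxShape` restates it in the crux's quantifier shape
(`∃ v δ₁ δ₂ ε P₅, … ∀ P ≥ P₅, ∃ k₀, ∀ k ≥ k₀, ε ≤ 2·R₂^{2^k P}(v)`, with `k₀ = 0`).
MECHANISM (no limit is taken): `tr G_T(z)G_T(−z) = 2 tr H_T(z)² + (tr H_T)² ≥ 2 tr H_T(z)²`
(`kT_eq`), and `tr H_T² = Σ_{(n,m)∈ℤ²} tr (∂∂|z_n|⁻²)(∂∂|z_m|⁻²)` (`trace_thermalHess_sq_ge`, via
`tsum_mul_tsum_of_summable_norm`) with EVERY cross term non-negative,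
`tr (∂∂|a|⁻²)(∂∂|b|⁻²) = (64(a·b)² − 16|a|²|b|²)/(|a|⁶|b|⁶) ≥ 0` whenever `a, b` lie in the double cone
`4|a⃗|² ≤ a₀²` (`trace_hessInvSq_mul`, `cone_criterion`), which all images `z + nTe₀` of a window
separation do once `T ≥ 3ℓ` (`cone_img`); so the thermal density dominates the vacuum density
`96/|z|⁸` termwise (`kvac_le_kT`), and the vacuum floor is `ℓ`-free by `−8 = −2·dim[F²]`
homogeneity (`κTh_eq`).  Upper bounds (integrability): `|H_T(z)_{μρ}| ≤ C_ℓ·Σₙ(n²+1)⁻²` on the window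
(`abs_thermalHess_le`); measurability of `z ↦ H_T(z)` as the pointwise limit of symmetric partial sums
(`measurable_thermalHess_entry`).

**Separation (S's analogue FALSE in the SAME model — `thermalMaxwell_NT_clauseII_false`).** `H_T(z)`
is symmetric and traceless (`thermalHess_trace`: the trace commutes with the convergent image sum), so
the landed `treeLevelSkewness_vanishes` gives `tr G_T G_T G_T ≡ 0` pointwise and `R₃^T ≡ 0` for all
test functions at EVERY `T > 0` (`thermalRing3_eq_zero`), as in the vacuum (`vacuumRing3_eq_zero`):
NT's clause (ii) admits no floor in the model while the crux's floor clause holds uniformly down to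
zero temperature — `thermalMaxwell_separates`.  The witness thus exercises exactly the part of the crux
NT does not contain (uniformity in the time extent `2^k`), in a regime (abelian, free) where `NT` is
decided FALSE, and shows that no proof of `ZeroTemperatureFloors → NT(ii)` can avoid non-abelian input
(the route's declared residual `SkewFloors`).

NOTHING HERE PROVES `ZeroTemperatureFloors`, `NT`, or the Yang–Mills mass gap: free-field Gaussian analysis on `ℝ⁴`,
a witness (R3/RECORD framing) that the deciding crux has content of its own outside NT's printed regime.
[cite: OsterwalderSeilerAnnPhys1978, §2–3; Luscher1977; GlimmJaffe1987, §6.3, §7]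
-/

set_option autoImplicit false

open scoped SchwartzMap BigOperators Topology
open MeasureTheory Filter Topology Matrix Metric Set
open Literature.MathematicalPhysics.QuantumLattice

noncomputable section

namespace Summit.QuantumFields.YangMills.Theorems.ThermalDescent.MaxwellRung
open Summit.QuantumFields.YangMills.Theorems.SelfNormalisedSkewness.Negative

/-! ## §E The thermal and vacuum ring functionals; the floors; the separation -/

/-- `R₃ ≡ 0`. [folklore] -/
theorem vacuumRing3_eq_zero (f g h : 𝓢(E4, ℝ)) : vacuumRing3 f g h = 0 := by
  -- the vacuum odd ring vanishes pointwise (`treeLevelSkewness_vanishes`; cf. the tree's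
  -- `SelfNormalisedSkewness.Negative.maxwellOddRing_eq_zero` for the cone-bound copy of `maxwellKernel`)
  have hodd : ∀ x y z : E4,
      (maxwellKernel (x - y) * maxwellKernel (y - z) * maxwellKernel (z - x)).trace = 0 := fun x y z =>
    treeLevelSkewness_vanishes _ _ _ (hessInvSq_isSymm _) (hessInvSq_isSymm _) (hessInvSq_isSymm _)
      (hessInvSq_trace _) (hessInvSq_trace _) (hessInvSq_trace _)
  simp [vacuumRing3, hodd]

/-- The vacuum even ring in closed form: `tr G(z)G(−z) = 96/|z|⁸`. [folklore] -/
theorem trace_ring_eq_kvac (z : E4) : (maxwellKernel z * maxwellKernel (-z)).trace = kvac z := by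
  rw [maxwellKernel_neg, maxwellKernel, trace_K_mul_K_of_isSymm (hessInvSq_isSymm z) (hessInvSq_isSymm z),
    hessInvSq_trace, trace_hessInvSq_sq, kvac]
  ring

/-- The thermal even ring is `k_T`, by definition. [this route] -/
theorem trace_ring_eq_kT (T : ℝ) (z : E4) : (thermalKernel T z * thermalKernel T (-z)).trace = kT T z :=
  rfl

/-- `k_∞ ≥ 0`. [folklore] -/
theorem kvac_nonneg (z : E4) : 0 ≤ kvac z := by
  unfold kvac
  exact div_nonneg (by norm_num) (pow_nonneg (nsq_nonneg z) 4)

/-- `k_∞` is measurable. [folklore] -/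
theorem measurable_kvac : Measurable kvac :=
  measurable_const.div (continuous_nsq.measurable.pow_const 4)

/-- `k_∞ ≥ k_min(ℓ)` on the window. [this route] -/
theorem kvac_lower {ℓ : ℝ} (hℓ : 0 < ℓ) {z : E4} (hz : z ∈ W ℓ) : kmin ℓ ≤ kvac z := by
  unfold kmin kvac
  exact div_le_div_of_nonneg_left (by norm_num) (pow_pos (nsq_pos_of_mem_W hℓ hz) 4)
    (pow_le_pow_left₀ (nsq_nonneg z) (nsq_le_of_mem_W hz) 4)

/-- `k_∞ ≤ 96/(9ℓ²/16)⁴` on the window. [this route] -/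
theorem kvac_upper {ℓ : ℝ} (hℓ : 0 < ℓ) {z : E4} (hz : z ∈ W ℓ) :
    kvac z ≤ 96 / (9 * ℓ ^ 2 / 16) ^ 4 := by
  have h1 : 9 * ℓ ^ 2 / 16 ≤ nsq z := by
    have := time_sq_le_nsq z
    nlinarith [hz.1]
  unfold kvac
  exact div_le_div_of_nonneg_left (by norm_num) (by positivity) (pow_le_pow_left₀ (by positivity) h1 4)

/-- **Thermal dominates vacuum on the window, termwise** (`T ≥ 3ℓ`): `k_∞(z) ≤ k_T(z)`. [this route] -/
theorem kvac_le_kT {ℓ T : ℝ} (hℓ : 0 < ℓ) (hT : 3 * ℓ ≤ T) {z : E4} (hz : z ∈ W ℓ) :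
    kvac z ≤ kT T z := by
  have h1 := trace_thermalHess_sq_ge hℓ hT hz
  rw [kT_eq, kvac]
  have h96 : 96 / nsq z ^ 4 = 2 * (48 / nsq z ^ 4) := by ring
  rw [h96]
  nlinarith [sq_nonneg (thermalHess T z).trace]

/-- `κ > 0`. [this route] -/
theorem κTh_pos : 0 < κTh := by
  have hV : 0 < unitBallVol := by
    rw [unitBallVol, measureReal_def]
    exact ENNReal.toReal_pos (measure_ball_pos volume (0 : E4) one_pos).ne' measure_ball_lt_top.ne
  unfold κTh
  positivity

/-- `κ` is the window floor times the two inner-ball volumes, at every scale (`−8 = −2·dim[F²]` homogeneity). [this route] -/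
theorem κTh_eq {ℓ : ℝ} (hℓ : 0 < ℓ) :
    κTh = 2 * (kmin ℓ * ((ℓ / 16) ^ 4 * unitBallVol) * ((ℓ / 16) ^ 4 * unitBallVol)) := by
  unfold κTh kmin
  have hℓ0 : ℓ ≠ 0 := hℓ.ne'
  field_simp

/-- The vacuum floor at scale `ℓ` (the `T = ∞` member; FRM's mirror floor in slab geometry).
[this route] -/
theorem vacuumRing2_floor {ℓ : ℝ} (hℓ : 0 < ℓ) : κTh ≤ 2 * vacuumRing2 (wfun ℓ hℓ) := by
  have h := ring2_floor hℓ kvac measurable_kvac kvac_nonneg (fun z hz => kvac_lower hℓ hz)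
    (fun z hz => kvac_upper hℓ hz) (G := maxwellKernel) trace_ring_eq_kvac
  rw [κTh_eq hℓ]
  unfold vacuumRing2
  unfold unitBallVol
  linarith

/-- **The thermal floor at scale `ℓ`, uniform in the period `T ≥ 3ℓ`**. [this route] -/
theorem thermalRing2_floor {ℓ T : ℝ} (hℓ : 0 < ℓ) (hT : 3 * ℓ ≤ T) :
    κTh ≤ 2 * thermalRing2 T (wfun ℓ hℓ) := by
  have hT0 : 0 < T := by linarith
  have h := ring2_floor hℓ (kT T) (measurable_kT hT0) (kT_nonneg T) (fun z hz => kT_lower hℓ hT hz)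
    (fun z hz => kT_upper hℓ hT hz) (G := thermalKernel T) (trace_ring_eq_kT T)
  rw [κTh_eq hℓ]
  unfold thermalRing2
  unfold unitBallVol
  linarith

/-- **MAIN THEOREM (the rung): the thermal free-Maxwell zero-temperature floor.**
One constant `κ > 0` such that at EVERY scale `ℓ > 0` one `[0,1]`-valued slab mode `w_ℓ`
(supported in the time slab `ℓ/4 < x₀ < 3ℓ/4`) has reflected Wick-square covariance
`2·R₂^T(w_ℓ) ≥ κ` for EVERY inverse temperature `T ≥ 3ℓ` — uniformly as `T → ∞` — and the same
floor for the vacuum functional `2·R₂(w_ℓ)`.  This is the free-field (formal `β → ∞`, `G = U(1)`,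
continuum) analogue of the crux `ZeroTemperatureFloors`' floor clause: a reflected plaquette-energy
covariance floor `ε > 0` surviving the zero-temperature limit along the time direction, for a test
function supported in a fixed positive-time slab.  No `T → ∞` limit is taken: every cross-image
term of the thermal density is non-negative on the window (`cross_nonneg`). [this route] -/
theorem thermalMaxwell_zeroTemperatureFloor :
    ∃ κ : ℝ, 0 < κ ∧ ∀ ℓ : ℝ, 0 < ℓ →
      ∃ w : 𝓢(E4, ℝ), tsupport (w : E4 → ℝ) ⊆ {y | ℓ / 4 < y 0 ∧ y 0 < 3 * ℓ / 4} ∧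
        (∀ z, 0 ≤ w z ∧ w z ≤ 1) ∧ κ ≤ 2 * vacuumRing2 w ∧
        ∀ T : ℝ, 3 * ℓ ≤ T → κ ≤ 2 * thermalRing2 T w :=
  ⟨κTh, κTh_pos, fun ℓ hℓ => ⟨wfun ℓ hℓ, wfun_tsupport_slab hℓ,
    fun z => ⟨wfun_nonneg hℓ z, wfun_le_one hℓ z⟩, vacuumRing2_floor hℓ,
    fun _ hT => thermalRing2_floor hℓ hT⟩⟩

/-- **The rung in the quantifier shape of the crux's floor clause** (`ZeroTemperatureFloors`:
`∃ v δ₁ δ₂ ε β₅ Λ₅, 0 < δ₁ ∧ tsupport v ⊆ {δ₁ < y₀ < δ₂} ∧ 0 < ε ∧ ∀ β ≥ β₅, ∀ L, Λ₅ ≤ a(β)L →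
∃ k₀, ∀ k ≥ k₀, ε ≤ Qrp β (2L+1) (2^k(2L+1)) (a β) v`), with the lattice covariance `Qrp` at time
extent `2^k(2L+1)` replaced by its free-Maxwell value `2·R₂^T` at the physical period `T = 2^k·P`
(`P ≥ P₅` the spatial period; `β` is absent in the free model, which is already its formal
`β → ∞` limit): ONE test function, ONE `ε`, the floor holding along EVERY doubling chain of periods
with `k₀ = 0`. [this route] -/
theorem thermalMaxwell_zeroTemperatureFloor_cruxShape :
    ∃ (v : 𝓢(E4, ℝ)) (δ₁ δ₂ ε P₅ : ℝ), 0 < δ₁ ∧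
      tsupport (v : E4 → ℝ) ⊆ {y | δ₁ < y 0 ∧ y 0 < δ₂} ∧ 0 < ε ∧
      ∀ P : ℝ, P₅ ≤ P → ∃ k₀ : ℕ, ∀ k : ℕ, k₀ ≤ k → ε ≤ 2 * thermalRing2 (2 ^ k * P) v := by
  refine ⟨wfun 1 one_pos, 1 / 4, 3 / 4, κTh, 3, by norm_num, ?_, κTh_pos, fun P hP => ⟨0, fun k _ => ?_⟩⟩
  · simpa using wfun_tsupport_slab (ℓ := 1) one_pos
  · refine thermalRing2_floor one_pos ?_
    have h1 : (1 : ℝ) ≤ 2 ^ k := one_le_pow₀ (by norm_num)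
    nlinarith

/-! ### The separation: NT's clause (ii) analogue is FALSE in the same model, at every temperature -/

/-- **The thermal odd ring vanishes at all points and all temperatures** (`T > 0`):
`tr G_T(x−y)G_T(y−z)G_T(z−x) = 0` — `treeLevelSkewness_vanishes` at the periodised Hessians, which
are symmetric and traceless (the image sum of harmonic Hessians is harmonic). [this route] -/
theorem thermalOddRing_eq_zero {T : ℝ} (hT : 0 < T) (x y z : E4) :
    (thermalKernel T (x - y) * thermalKernel T (y - z) * thermalKernel T (z - x)).trace = 0 :=
  treeLevelSkewness_vanishes _ _ _ (thermalHess_isSymm _ _) (thermalHess_isSymm _ _)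
    (thermalHess_isSymm _ _) (thermalHess_trace hT _) (thermalHess_trace hT _) (thermalHess_trace hT _)

/-- `R₃^T ≡ 0` for all test functions, every `T > 0`. [this route] -/
theorem thermalRing3_eq_zero {T : ℝ} (hT : 0 < T) (f g h : 𝓢(E4, ℝ)) : thermalRing3 T f g h = 0 := by
  simp [thermalRing3, thermalOddRing_eq_zero hT]

/-- **NT clause (ii) fails in the thermal free-Maxwell model at every temperature**: the connected
three-point functional of the Wick square (`κ₃ = 8·R₃^T`) admits NO floor `ε > 0`, for any triple
of test functions — while the zero-temperature floor above (clause-(iii)/crux side) holds. [this route] -/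
theorem thermalMaxwell_NT_clauseII_false {T : ℝ} (hT : 0 < T) :
    ¬ ∃ (f g h : 𝓢(E4, ℝ)) (ε : ℝ), 0 < ε ∧ ε ≤ |8 * thermalRing3 T f g h| := by
  rintro ⟨f, g, h, ε, hε, hle⟩
  rw [thermalRing3_eq_zero hT] at hle
  norm_num at hle
  linarith

/-- The vacuum version (`T = ∞`): `vacuumRing3 ≡ 0` admits no floor either. [folklore] -/
theorem maxwell_NT_clauseII_false :
    ¬ ∃ (f g h : 𝓢(E4, ℝ)) (ε : ℝ), 0 < ε ∧ ε ≤ |8 * vacuumRing3 f g h| := by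
  rintro ⟨f, g, h, ε, hε, hle⟩
  rw [vacuumRing3_eq_zero] at hle
  norm_num at hle
  linarith

/-- **The separation packaged**: in ONE decided model (thermal free Maxwell, all periods) the crux's
floor-clause analogue is TRUE, uniformly down to zero temperature, while the sub-problem statement's
clause-(ii) analogue is FALSE at every temperature and in the vacuum — a witness that
`ZeroTemperatureFloors` has content not implied by, and not implying, `NT`'s printed regime.
[this route] -/
theorem thermalMaxwell_separates :
    (∃ κ : ℝ, 0 < κ ∧ ∀ ℓ : ℝ, 0 < ℓ →
      ∃ w : 𝓢(E4, ℝ), tsupport (w : E4 → ℝ) ⊆ {y | ℓ / 4 < y 0 ∧ y 0 < 3 * ℓ / 4} ∧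
        (∀ z, 0 ≤ w z ∧ w z ≤ 1) ∧ κ ≤ 2 * vacuumRing2 w ∧
        ∀ T : ℝ, 3 * ℓ ≤ T → κ ≤ 2 * thermalRing2 T w) ∧
    (∀ T : ℝ, 0 < T → ¬ ∃ (f g h : 𝓢(E4, ℝ)) (ε : ℝ), 0 < ε ∧ ε ≤ |8 * thermalRing3 T f g h|) ∧
    ¬ ∃ (f g h : 𝓢(E4, ℝ)) (ε : ℝ), 0 < ε ∧ ε ≤ |8 * vacuumRing3 f g h| :=
  ⟨thermalMaxwell_zeroTemperatureFloor, fun _ hT => thermalMaxwell_NT_clauseII_false hT,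
    maxwell_NT_clauseII_false⟩

end Summit.QuantumFields.YangMills.Theorems.ThermalDescent.MaxwellRung

end
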